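import Literature.IUT.HodgeTheaters.InitialThetaDataTripod
import Literature.IUT.HodgeTheaters.InitialThetaDataOfModelPlaces
import Literature.IUT.LogVolume.Corollary22FullGaloisImage
import Literature.IUT.LogVolume.Corollary22GaloisImage
import Literature.IUT.LogVolume.InitialThetaDataVolume
import HarnessLib

/-!
# Initial Θ-data for a point of the `λ`-line from the conditions (P2), (P4), (P5) of [IUTchIV] Cor. 2.2 (ii)

Mochizuki, *Inter-universal Teichmüller theory IV*, RIMS manuscript (Apr. 2020; = PRIMS **57** (2021)),
proof of Cor. 2.2 (ii), pp. 45–46: "(P2) `l` does not divide any nonzero `h_v`… (P4) `E_F` does not admit an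
`l`-cyclic subgroup scheme… (P5) `𝕍^bad_mod := ` the nonarchimedean valuations of `F_mod` that do not divide
`2l` and at which `E_F` has bad multiplicative reduction; then `𝕍^bad_mod ≠ ∅`… (P6) the image of
`Gal(ℚ̄/F) → GL₂(𝔽_l)` contains `SL₂(𝔽_l)` [follows formally from (P2), (P4), and [GenEll], Lemma 3.1 (iii)]…
it follows formally from (P1), (P2), (P5), and (P6) that, if one takes … “`F`” to be the number field `F`,
“`X_F`” to be the once-punctured elliptic curve associated to `E_F`, “`l`” to be the prime number `l`, and
“`𝕍^bad_mod`” to be the set `𝕍^bad_mod` of (P5), then there exist data … such that all of the conditions of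
[IUTchI], Definition 3.1, (a), (b), (c), (d), (e), (f), are satisfied … (P7)".

The route's layer-2 child (i) «ThetaDataExists(P, l)», ARITHMETIC HALF, for a point `λ = P.x` of the
`λ`-line minimally presented over `F_tpd = P.F` (`P ∈ Cor22.UP`), in the reading `E_F := W ⊗ F`, `W` the
`F_mod`-model `modCurve P`, `F := F_mod(√−1, W[2·3·5])` (`InitialThetaDataTripod.lean`; finding F-L5t7-1):

* `ord_modelJ_eq_mul`: `ord_w(j(E_F)) = e(w|v)·ord_v(j(λ))` along `F_tpd ↪ F` (campaign-S dictionary);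
* `nonempty_badSet_of_condP5`: **(P5) over `F_tpd` gives a (P5) place of `F`** (over the (P5) place `v ∤ 2l`
  of `F_tpd` any `w | v` is of bad multiplicative reduction — `E_F` is semistable and `ord_w j < 0` — and
  `w ∤ 2l`);
* `not_dvd_ord_of_condP2`: **(P2) over `F_tpd` gives (P2) over `F` for primes `l ≥ 7`**
  (`l ∤ e(w|v) ∣ [F : F_tpd] ∣ 2^{11}·3^3·5`);
* `placeInputOf`: (P2) + (P5) + (P4) [`¬ AdmitsLCyclic`, whence (P6) by
  `imageContainsSL2_of_not_admitsLCyclic`] give the `PlaceInput` of `InitialThetaDataOfModelPlaces.lean`;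
  `exists_HK_not_admitsLCyclic`: on a compactly bounded `K_V`, (P4) holds above a height threshold `H_K`
  ([GenEll] Lem. 3.5 route of `Corollary22FullGaloisImage.lean`, degree hypothesis in the form `l ∤ [F':F_tpd]`);
* **`exists_initialThetaData_of_conditions`**: for `P ∈ U_P`, a prime `l ≥ 7` with (P2), (P5), (P4), initial
  Θ-data `(F̄/F, X_F = E_F ∖ 0, l, C̲_K, 𝕍̲, 𝕍^bad_mod, ε̲)` in the sense of `InitialThetaData` EXIST with
  `E_F = W ⊗ F`, `F_mod(D) = ℚ(j(λ))`, `𝕍^bad_mod =` the places of `F_mod` under the (P5) places (which IS the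
  (P5) choice, `isP5Choice_of_VbadMod_eq` / `ThetaData.IsP5Choice`) — modulo ONLY the `π₁`-geometric interface of [IUTchI] Def. 3.1 (d)(e)(f) (`BadPlacePredicates`, `ThetaGeometry`),
  which the tree types but does not construct (campaign L).

Construction file; TAKES NO SIDE on [IUTchIII] Cor. 3.12 (Θ-data EXIST classically; what Thm. 1.10 asserts
about them is the disputed part and is not touched here).
-/

noncomputable section

open scoped Classical
open Polynomial IntermediateField NumberField IsDedekindDomain
open Literature.NumberTheory.DiophantineGeometry.GenEll Literature.IUT.LogVolume
open Literature.NumberTheory.EllipticCurves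

universe u

namespace Literature.IUT.HodgeTheaters

/-! ## `E_F = W ⊗ F` is semistable -/

section Model

variable {K₀ : Type u} [Field K₀] [NumberField K₀] (W : WeierstrassCurve K₀) [W.IsElliptic]

/-- **`E_F = W ⊗ F` is semistable** (its `15`-torsion is `F`-rational: [IUTchIV] Prop. 1.8 (v), the tree's
`isSemistable_of_torsion_rational_fifteen`). [cite: Mochizuki2012, IUTchIV Cor 2.2 (ii) p.42] -/
theorem modelCurve_isSemistable : (modelCurve W).IsSemistable (𝓞 (ThetaF W)) :=
  (modelCurve W).isSemistable_of_torsion_rational_fifteen fun P hP => by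
    have h30 : (30 : ℤ) • P = 0 := by
      rw [show (30 : ℤ) = 2 * 15 by norm_num, mul_smul, hP, smul_zero]
    exact torsion_thirty_rational W P h30

end Model

/-! ## `𝕍^bad_mod =` the places under the (P5) places IS the (P5) choice -/

section P5Choice

variable {K₀ : Type} [Field K₀] [NumberField K₀] (W : WeierstrassCurve K₀) [W.IsElliptic]
  {K Fbar : Type} [Field K] [NumberField K] [Algebra (ThetaF W) K] [Field Fbar] [Algebra (ThetaF W) Fbar]
  [Algebra K Fbar] {l : ℕ} {Pb : BadPlacePredicates K}

/-- The residue characteristic of a finite place `x` of `F` divides `n` iff `n ∈ 𝔪_x`; two places of `F` over the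
same place of `F_mod` have the same residue characteristic. Hence: `n ∈ 𝔪_x ↔ n ∈ 𝔪_w` whenever `x` and `w`
lie over the same place of `F_mod`. [cite: Mochizuki2012, IUTchIV Cor 2.2 proof (P5) p.46] -/
theorem natCast_mem_iff_of_finBelow_eq {x : FinitePlace (ThetaF W)} {w : HeightOneSpectrum (𝓞 (ThetaF W))}
    (h : InitialThetaData.finBelow (E := modelCurve W) x =
      InitialThetaData.finBelow (E := modelCurve W) (FinitePlace.mk w)) (n : ℕ) :
    ((n : ℕ) : 𝓞 (ThetaF W)) ∈ x.maximalIdeal.asIdeal ↔ ((n : ℕ) : 𝓞 (ThetaF W)) ∈ w.asIdeal := by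
  have hchar : ringChar (𝓞 (ThetaF W) ⧸ x.maximalIdeal.asIdeal) = ringChar (𝓞 (ThetaF W) ⧸ w.asIdeal) := by
    rw [← residueChar_finBelow_eq W w, ← residueChar_finBelow_eq W x.maximalIdeal, FinitePlace.mk_maximalIdeal, h]
  rw [← natCast_quotient_eq_zero_iff W x.maximalIdeal n, ← natCast_quotient_eq_zero_iff W w n, ringChar.spec,
    ringChar.spec, hchar]

/-- **`𝕍^bad_mod :=` the places of `F_mod` under the (P5) places of `F` IS the (P5) choice** in the sense of
`ThetaData.IsP5Choice` (abc-iut-c312-8's point dictionary): a finite place of `F` lies over it iff it divides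
neither `2` nor `l` and `E_F` has bad multiplicative reduction there (over a bad place of `F_mod` EVERY place of `F`
is multiplicative — `F/F_mod` Galois — and has the same residue characteristic).
[cite: Mochizuki2012, IUTchIV Cor 2.2 proof (P5) p.46] -/
theorem isP5Choice_of_VbadMod_eq (D : InitialThetaData (ThetaF W) K Fbar (modelCurve W) l Pb)
    (hD : D.VbadMod = VbadModOf W l) : ThetaData.IsP5Choice D := by
  intro v
  change Val.restrict (fieldOfModuli (modelCurve W)) (Val.non v) ∈ Val.non '' D.VbadMod ↔ _
  rw [hD, restrict_mem_iff W v]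
  constructor
  · rintro ⟨w, hw, h⟩
    refine ⟨fun p hp => ?_, multiplicative_over_VbadModOf W v ((restrict_mem_iff W v).mpr ⟨w, hw, h⟩)⟩
    simp only [Finset.mem_insert, Finset.mem_singleton] at hp
    rcases hp with rfl | rfl
    · rw [natCast_mem_iff_of_finBelow_eq W h]; exact hw.2.1
    · rw [natCast_mem_iff_of_finBelow_eq W h]; exact hw.2.2
  · rintro ⟨hp, hmult⟩
    refine ⟨v.maximalIdeal, ⟨hmult, hp 2 (by simp), hp l (by simp)⟩, ?_⟩
    rw [FinitePlace.mk_maximalIdeal]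

end P5Choice

/-! ## The `λ`-line ↔ `M_ell` dictionary with the degree hypothesis `l ∤ [F' : F_tpd]` -/

section Dictionary

variable {P : NFPoint} (Q : EllPoint) [Algebra P.F Q.F] (hj : Q.W.j = algebraMap P.F Q.F (Cor22.jInv P.x))
include hj

/-- **(P2) over `F_tpd` gives "`l` prime to the local heights of `Q`"** for `F'/F_tpd` Galois with
`l ∤ [F' : F_tpd]` (variant of `Cor22.not_dvd_localHeight_of_condP2`, whose degree hypothesis
`[F':F_tpd] ∣ 46080` is replaced by the one the argument uses: `h_w = e(w|v)·(−ord_v j(λ))`, `l ∤ ord_v j(λ)`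
by (P2), `l ∤ e(w|v) ∣ [F' : F_tpd]`). [cite: Mochizuki2012, IUTchIV Cor 2.2 proof (P2)/(P4) p.45] -/
theorem not_dvd_localHeight_of_condP2_of_not_dvd [IsGalois P.F Q.F] {l : ℕ} (hl : l.Prime)
    (hlF : ¬ l ∣ Module.finrank P.F Q.F) (hP2 : Cor22.CondP2 P l) (w : HeightOneSpectrum (𝓞 Q.F))
    (hw : Q.W.HasMultiplicativeReductionAt w) : ¬ ((l : ℤ) ∣ Q.localHeight w) := by
  haveI : (w.asIdeal.under (𝓞 P.F)).IsPrime := Ideal.IsPrime.under (𝓞 P.F) w.asIdeal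
  set v : HeightOneSpectrum (𝓞 P.F) :=
    ⟨w.asIdeal.under (𝓞 P.F), inferInstance, Ideal.under_ne_bot (A := 𝓞 P.F) w.ne_bot⟩ with hv
  haveI hover : w.asIdeal.LiesOver v.asIdeal := Ideal.over_under (A := 𝓞 P.F) w.asIdeal
  haveI : v.asIdeal.IsMaximal := v.isMaximal
  haveI : w.asIdeal.IsPrime := w.isPrime
  have hloc := Cor22.localHeight_eq_mul Q hj w v
  rw [Ideal.ramificationIdx'_eq_ramificationIdx (p := v.asIdeal) (q := w.asIdeal) v.ne_bot] at hloc
  have hpos := Q.localHeight_pos_of_hasMultiplicativeReductionAt w hw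
  have he : w.asIdeal.ramificationIdx (𝓞 P.F) ∣ Module.finrank P.F Q.F :=
    Literature.NumberTheory.NumberFields.ramificationIdx_dvd_finrank_of_isGalois v.asIdeal w.asIdeal
  have hle : ¬ l ∣ w.asIdeal.ramificationIdx (𝓞 P.F) := fun h => hlF (h.trans he)
  have hord : ord P.F v (Cor22.jInv P.x) < 0 := by
    rw [hloc] at hpos
    by_contra hge
    push Not at hge
    have : (w.asIdeal.ramificationIdx (𝓞 P.F) : ℤ) * (-ord P.F v (Cor22.jInv P.x)) ≤ 0 :=
      mul_nonpos_of_nonneg_of_nonpos (Int.natCast_nonneg _) (by omega)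
    exact absurd hpos (not_lt.mpr this)
  have hP2v := hP2 v hord
  rw [hloc]
  intro hdvd
  have hlp : Prime (l : ℤ) := Nat.prime_iff_prime_int.mp hl
  rcases hlp.dvd_or_dvd hdvd with h1 | h2
  · exact hle (Int.natCast_dvd_natCast.mp h1)
  · exact hP2v ((dvd_neg).mp h2)

omit hj Q in
/-- **(P4), quantitative form** with the degree hypothesis `l ∤ [F' : F_tpd]` (variant of
`Cor22.exists_logQForall_le_of_admitsLCyclic`): for a compactly bounded `K_V` there is `H_K` such that for
`λ ∈ K_V`, `Q = E_{F'}` semistable with `j(Q) = j(λ)`, `F'/F_tpd` Galois, a prime `l ∤ [F':F_tpd]` with (P2),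
an `l`-cyclic subgroup scheme of `Q` forces `log(q^∀(λ)) ≤ H_K` ([GenEll] Lem. 3.5 + Prop. 3.4 through
`exists_htInf_le_of_admitsLCyclic`, Cor. 2.2 (i)). [cite: Mochizuki2012, IUTchIV Cor 2.2 proof (P4) p.45] -/
theorem exists_logQForall_le_of_admitsLCyclic_of_not_dvd (D : CBData) :
    ∃ HK : ℝ, ∀ P : NFPoint, D.Mem P → ∀ (Q : EllPoint) [Algebra P.F Q.F] [IsGalois P.F Q.F],
      Q.W.j = algebraMap P.F Q.F (Cor22.jInv P.x) → Q.IsSemistable →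
        ∀ l : ℕ, l.Prime → ¬ l ∣ Module.finrank P.F Q.F → Cor22.CondP2 P l → Q.AdmitsLCyclic l →
          Cor22.logQForall P ≤ HK := by
  obtain ⟨C, hC⟩ := Cor22.exists_jInv_bound D
  obtain ⟨B, hB⟩ := exists_htInf_le_of_admitsLCyclic C
  refine ⟨B, fun P hPD Q _ _ hj hss l hl hlF hP2 hcyc => ?_⟩
  have h1 := hB Q l hl hss (Cor22.norm_j_le_of_mem Q hj hPD hC)
    (not_dvd_localHeight_of_condP2_of_not_dvd Q hj hl hlF hP2) hcyc
  rw [Cor22.htInf_eq_htInfty Q hj] at h1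
  exact (Cor22.logQForall_le_htInfty P).trans h1

end Dictionary

/-! ## The point of the `λ`-line: `F`, `E_F`, and the conditions read over `F` -/

section LambdaLine

variable (P : NFPoint)

/-- `F := F_mod(√−1, W[2·3·5])` for the `F_mod`-model `W` of the point. [cite: Mochizuki2012, IUTchIV Cor 2.2 (ii) p.42] -/
abbrev FTheta : Type := ThetaF (modCurve P)

/-- `E_F := W ⊗_{F_mod} F`. [cite: Mochizuki2012, IUTchIV Cor 2.2 (ii) p.42] -/
abbrev ETheta : WeierstrassCurve (FTheta P) := modelCurve (modCurve P)

/-- `E_F` presented over `F` in the [GenEll] §3 vocabulary (`EllPoint`). [cite: Mochizuki2012, IUTchIV Cor 2.2 (ii) p.42] -/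
abbrev thetaEllPt : EllPoint := EllPoint.mk (FTheta P) (ETheta P)

/-- **`ord_w(j(E_F)) = e(w|v)·ord_v(j(λ))`** for a place `w` of `F` over a place `v` of `F_tpd` (along the
embedding `F_tpd ↪ F`). [cite: Mochizuki2012, IUTchIV Cor 2.2 proof p.44] -/
theorem ord_modelJ_eq_mul (hP : P ∈ UP) (v : HeightOneSpectrum (𝓞 P.F))
    (w : HeightOneSpectrum (𝓞 (FTheta P))) :
    letI := tpdAlgebra P hP
    w.asIdeal.LiesOver v.asIdeal →
      ord (FTheta P) w (ETheta P).j =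
        (v.asIdeal.ramificationIdx' w.asIdeal : ℤ) * ord P.F v (Cor22.jInv P.x) := by
  letI := tpdAlgebra P hP
  intro hvw
  rw [modelCurve_j_eq_algebraMap_jInv P hP]
  exact Cor22.ord_algebraMap_of_liesOver (FTheta P) v w (Cor22.jInv P.x)

/-- A place of `F` over a place `v ∤ n` of `F_tpd` does not divide `n`. [cite: Mochizuki2012, IUTchIV Cor 2.2 proof p.46] -/
theorem natCast_not_mem_of_liesOver (hP : P ∈ UP) (v : HeightOneSpectrum (𝓞 P.F))
    (w : HeightOneSpectrum (𝓞 (FTheta P))) {n : ℕ} (hv : ((n : ℕ) : 𝓞 P.F) ∉ v.asIdeal) :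
    letI := tpdAlgebra P hP
    w.asIdeal.LiesOver v.asIdeal → ((n : ℕ) : 𝓞 (FTheta P)) ∉ w.asIdeal := by
  letI := tpdAlgebra P hP
  intro hvw hmem
  apply hv
  have h2 : (n : 𝓞 P.F) ∈ w.asIdeal.under (𝓞 P.F) := by
    rw [Ideal.mem_comap, map_natCast]
    exact hmem
  rwa [← Ideal.LiesOver.over (P := w.asIdeal) (p := v.asIdeal)] at h2

/-- **(P5) over `F_tpd` gives a (P5) place of `F`**: over the place `v ∤ 2l` of `F_tpd` with `ord_v j(λ) < 0`
every place `w` of `F` is of bad multiplicative reduction for `E_F` (semistable, `ord_w j(E_F) =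
e·ord_v j(λ) < 0`) and `w ∤ 2l`. [cite: Mochizuki2012, IUTchIV Cor 2.2 proof (P5) p.46] -/
theorem nonempty_badSet_of_condP5 (hP : P ∈ UP) {l : ℕ} (hP5 : Cor22.CondP5 P l) :
    (badSet (modCurve P) l).Nonempty := by
  letI := tpdAlgebra P hP
  obtain ⟨v, hvj, hv2, hvl⟩ := hP5
  haveI : v.asIdeal.IsMaximal := v.isMaximal
  obtain ⟨⟨Pw, hPw⟩⟩ := (inferInstance : Nonempty (Ideal.primesOver v.asIdeal (𝓞 (FTheta P))))
  haveI : Pw.IsPrime := hPw.1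
  haveI : Pw.LiesOver v.asIdeal := hPw.2
  let w : HeightOneSpectrum (𝓞 (FTheta P)) := ⟨Pw, hPw.1, Ideal.ne_bot_of_liesOver_of_ne_bot v.ne_bot Pw⟩
  have hwv : w.asIdeal.LiesOver v.asIdeal := hPw.2
  have he0 : v.asIdeal.ramificationIdx' w.asIdeal ≠ 0 :=
    Ideal.IsDedekindDomain.ramificationIdx'_ne_zero_of_liesOver w.asIdeal v.ne_bot
  have hord : ord (FTheta P) w (ETheta P).j < 0 := by
    rw [ord_modelJ_eq_mul P hP v w hwv]
    exact mul_neg_of_pos_of_neg (by exact_mod_cast Nat.pos_of_ne_zero he0) hvj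
  exact ⟨w, hasMultiplicativeReductionAt_of_ord_j_neg (ETheta P) (modelCurve_isSemistable (modCurve P)) hord,
    natCast_not_mem_of_liesOver P hP v w hv2 hwv, natCast_not_mem_of_liesOver P hP v w hvl hwv⟩

/-- **(P2) over `F_tpd` gives (P2) over `F` for primes `l ≥ 7`**: at a place `w` of `F` of bad multiplicative
reduction, `l ∤ ord_w j(E_F) = −h_w` (`= e(w|v)·ord_v j(λ)` with `l ∤ ord_v j(λ)` by (P2) and
`l ∤ e(w|v) ∣ [F : F_tpd]`). [cite: Mochizuki2012, IUTchIV Cor 2.2 proof (P2) p.45] -/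
theorem not_dvd_ord_of_condP2 (hP : P ∈ UP) {l : ℕ} (hl : l.Prime) (h7 : 7 ≤ l) (hP2 : Cor22.CondP2 P l)
    (w : HeightOneSpectrum (𝓞 (FTheta P))) (hw : (ETheta P).HasMultiplicativeReductionAt w) :
    ¬ ((l : ℤ) ∣ ord (FTheta P) w (ETheta P).j) := by
  letI := tpdAlgebra P hP
  haveI := isGalois_tpd P hP
  have h := not_dvd_localHeight_of_condP2_of_not_dvd (thetaEllPt P) (modelCurve_j_eq_algebraMap_jInv P hP)
    hl (not_dvd_finrank_tpd P hP hl h7) hP2 w hw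
  rw [EllPoint.localHeight_eq_log] at h
  unfold ord
  rwa [dvd_neg]

/-- **The `F`-level inputs of (P7) from (P2), (P5), (P4)** for `P ∈ U_P` and a prime `l ≥ 7`: the
`PlaceInput` of `InitialThetaDataOfModelPlaces.lean` ((P6) over `F` from (P4) at the (P5) place,
`imageContainsSL2_of_not_admitsLCyclic`). [cite: Mochizuki2012, IUTchIV Cor 2.2 proof (P6) p.46] -/
theorem placeInputOf (hP : P ∈ UP) {l : ℕ} (hl : l.Prime) (h7 : 7 ≤ l) (hP2 : Cor22.CondP2 P l)
    (hP5 : Cor22.CondP5 P l) (hno : ¬ (thetaEllPt P).AdmitsLCyclic l) : PlaceInput (modCurve P) l where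
  l_prime := hl
  seven_le_l := h7
  exists_bad := nonempty_badSet_of_condP5 P hP hP5
  not_dvd_ord := fun w hw => not_dvd_ord_of_condP2 P hP hl h7 hP2 w hw.1
  imageContainsSL2 := by
    obtain ⟨w, hw⟩ := nonempty_badSet_of_condP5 P hP hP5
    haveI : Fact l.Prime := ⟨hl⟩
    exact imageContainsSL2_of_not_admitsLCyclic (modCurve P) hno hw.1 hw.2.2
      (not_dvd_ord_of_condP2 P hP hl h7 hP2 w hw.1)

/-- **(P4) above a height threshold**: for a compactly bounded `K_V` there is `H_K` such that for `λ ∈ K_V`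
minimally presented in `U_P`, a prime `l ≥ 7` with (P2), and `log(q^∀(λ)) > H_K`, the curve `E_F = W ⊗ F`
admits no `l`-cyclic subgroup scheme ([IUTchIV] p. 45 "(P4) … Indeed, the existence of an `l`-cyclic
subgroup scheme … would imply … that `log(q^∀)` is bounded"). [cite: Mochizuki2012, IUTchIV Cor 2.2 proof (P4) p.45] -/
theorem exists_HK_not_admitsLCyclic (D : CBData) :
    ∃ HK : ℝ, ∀ P : NFPoint, D.Mem P → P ∈ UP → ∀ l : ℕ, l.Prime → 7 ≤ l → Cor22.CondP2 P l →
      HK < Cor22.logQForall P → ¬ (thetaEllPt P).AdmitsLCyclic l := by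
  obtain ⟨HK, hHK⟩ := exists_logQForall_le_of_admitsLCyclic_of_not_dvd D
  refine ⟨HK, fun P hPD hP l hl h7 hP2 hgt hcyc => ?_⟩
  letI := tpdAlgebra P hP
  haveI := isGalois_tpd P hP
  have h := hHK P hPD (thetaEllPt P) (modelCurve_j_eq_algebraMap_jInv P hP)
    (modelCurve_isSemistable (modCurve P)) l hl (not_dvd_finrank_tpd P hP hl h7) hP2 hcyc
  exact absurd hgt (not_lt.mpr h)

/-- **The ARITHMETIC clauses of [IUTchI] Def. 3.1 at the point — constructed outright** (no `π₁`-geometric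
input): for `P ∈ U_P`, a prime `l ≥ 7` with (P2), (P5), (P4), the data and conditions (a) `√−1 ∈ F`,
(b) `E_F[2·3·5]` `F`-rational (hence semistable, `E_F[6]` rational), `F/F_mod` Galois of degree prime to `l`,
`𝕍^bad_mod ≠ ∅` odd places of `F_mod` of bad multiplicative reduction everywhere above, (c) `l ≥ 5` prime,
`SL₂(𝔽_l) ⊆ Im(G_F)`, `l ∤` residue characteristics and `q`-parameter orders over `𝕍^bad_mod`
(`ArithInput`, the input of `InitialThetaData.ofArith`) HOLD for `E_F = W ⊗ F`, `𝕍^bad_mod :=` the places of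
`F_mod` under the (P5) places. [cite: Mochizuki2012, IUTchIV Cor 2.2 proof (P7) p.46] -/
def arithInputAt (hP : P ∈ UP) {l : ℕ} (hl : l.Prime) (h7 : 7 ≤ l) (hP2 : Cor22.CondP2 P l)
    (hP5 : Cor22.CondP5 P l) (hno : ¬ (thetaEllPt P).AdmitsLCyclic l) : ArithInput (ETheta P) l :=
  arithInputOfModel (modCurve P) (adjoin_modCurve_j_eq_top P)
    (badPlaceInputOf (modCurve P) (adjoin_modCurve_j_eq_top P) (placeInputOf P hP hl h7 hP2 hP5 hno))

/-- The `𝕍^bad_mod` of the constructed arithmetic data is the set of places of `F_mod` under the (P5) places.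
[cite: Mochizuki2012, IUTchIV Cor 2.2 proof (P5) p.46] -/
theorem arithInputAt_VbadMod (hP : P ∈ UP) {l : ℕ} (hl : l.Prime) (h7 : 7 ≤ l) (hP2 : Cor22.CondP2 P l)
    (hP5 : Cor22.CondP5 P l) (hno : ¬ (thetaEllPt P).AdmitsLCyclic l) :
    (arithInputAt P hP hl h7 hP2 hP5 hno).VbadMod = VbadModOf (modCurve P) l := rfl

-- (instance search for `Algebra F K`, `K = F(E_F[l])`, over the nested subtype field `F` needs a larger budget)
set_option synthInstance.maxHeartbeats 200000 in
/-- **[IUTchIV] Cor. 2.2 (ii) (P7), arithmetic half, for a point of the `λ`-line — EXISTENCE of initial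
Θ-data.** For `λ ∈ U_P` minimally presented over `F_tpd`, a prime `l ≥ 7` with (P2) and (P5) over `F_tpd`
and (P4) for `E_F` over `F`: with `F_mod = ℚ(j(λ))`, `W` the `F_mod`-model, `F = F_mod(√−1, W[2·3·5])`,
`E_F = W ⊗ F`, `K = F(E_F[l])`, there EXIST initial Θ-data `(F̄/F, X_F, l, C̲_K, 𝕍̲, 𝕍^bad_mod, ε̲)`
(`InitialThetaData`, [IUTchI] Def. 3.1 (a)–(f)) with `𝕍^bad_mod =` the places of `F_mod` under the (P5)
places of `F` — GIVEN the `π₁`-geometric interface of Def. 3.1 (d)(e)(f) at these places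
(`BadPlacePredicates`, `ThetaGeometry`: typed in the tree, constructed by campaign L, not here).
[claim: Mochizuki2012, status: disputed] -/
theorem exists_initialThetaData_of_conditions (hP : P ∈ UP) {l : ℕ} [NeZero l] (hl : l.Prime)
    (h7 : 7 ≤ l) (hP2 : Cor22.CondP2 P l) (hP5 : Cor22.CondP5 P l) (hno : ¬ (thetaEllPt P).AdmitsLCyclic l)
    (Pb : BadPlacePredicates (TorsionField (ETheta P) l))
    (geom : ThetaGeometry.{0} (AlgebraicClosure (FTheta P) ≃ₐ[FTheta P] AlgebraicClosure (FTheta P))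
      (galoisSubgroupOf (FTheta P) (TorsionField (ETheta P) l) (AlgebraicClosure (FTheta P))) l)
    (hbad_type : ∀ w : Val (TorsionField (ETheta P) l),
      toVMod (FTheta P) (TorsionField (ETheta P) l) (ETheta P) w ∈ Val.non '' VbadModOf (modCurve P) l →
        Pb.IsTypeOneZModLPM w)
    (hbad_cusp : ∀ w : Val (TorsionField (ETheta P) l),
      toVMod (FTheta P) (TorsionField (ETheta P) l) (ETheta P) w ∈ Val.non '' VbadModOf (modCurve P) l →
        Pb.IsCanonicalGeneratorCusp w) :
    ∃ D : InitialThetaData (FTheta P) (TorsionField (ETheta P) l) (AlgebraicClosure (FTheta P))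
        (ETheta P) l Pb, D.VbadMod = VbadModOf (modCurve P) l ∧ ThetaData.IsP5Choice D := by
  obtain ⟨D, hD⟩ := exists_initialThetaData_ofPlaceInput (modCurve P) (adjoin_modCurve_j_eq_top P)
    (placeInputOf P hP hl h7 hP2 hP5 hno) Pb geom hbad_type hbad_cusp
  exact ⟨D, hD, isP5Choice_of_VbadMod_eq (modCurve P) D hD⟩

set_option synthInstance.maxHeartbeats 200000 in
/-- The same on a compactly bounded `K_V` with (P4) discharged by the height threshold: for `λ ∈ K_V ∩ U_P`,
a prime `l ≥ 7` with (P2), (P5) and `log(q^∀(λ)) > H_K`, initial Θ-data as above exist (given the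
`π₁`-geometric interface). [claim: Mochizuki2012, status: disputed] -/
theorem exists_HK_initialThetaData (D : CBData) :
    ∃ HK : ℝ, ∀ P : NFPoint, D.Mem P → ∀ hP : P ∈ UP, ∀ l : ℕ, ∀ _ : NeZero l, l.Prime → 7 ≤ l →
      Cor22.CondP2 P l → Cor22.CondP5 P l → HK < Cor22.logQForall P →
      ∀ (Pb : BadPlacePredicates (TorsionField (ETheta P) l))
        (geom : ThetaGeometry.{0} (AlgebraicClosure (FTheta P) ≃ₐ[FTheta P] AlgebraicClosure (FTheta P))
          (galoisSubgroupOf (FTheta P) (TorsionField (ETheta P) l) (AlgebraicClosure (FTheta P))) l),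
        (∀ w : Val (TorsionField (ETheta P) l),
          toVMod (FTheta P) (TorsionField (ETheta P) l) (ETheta P) w ∈ Val.non '' VbadModOf (modCurve P) l →
            Pb.IsTypeOneZModLPM w) →
        (∀ w : Val (TorsionField (ETheta P) l),
          toVMod (FTheta P) (TorsionField (ETheta P) l) (ETheta P) w ∈ Val.non '' VbadModOf (modCurve P) l →
            Pb.IsCanonicalGeneratorCusp w) →
        ∃ D : InitialThetaData (FTheta P) (TorsionField (ETheta P) l) (AlgebraicClosure (FTheta P))
          (ETheta P) l Pb, D.VbadMod = VbadModOf (modCurve P) l ∧ ThetaData.IsP5Choice D := by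
  obtain ⟨HK, hHK⟩ := exists_HK_not_admitsLCyclic D
  exact ⟨HK, fun P hPD hP l _ hl h7 hP2 hP5 hgt Pb geom hbad_type hbad_cusp =>
    exists_initialThetaData_of_conditions P hP hl h7 hP2 hP5 (hHK P hPD hP l hl h7 hP2 hgt)
      Pb geom hbad_type hbad_cusp⟩

end LambdaLine

end Literature.IUT.HodgeTheaters

end

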